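import Literature.RepresentationTheory.HarrisKudlaSweet1996.GlobalSplittingCharacters
import Literature.NumberTheory.Automorphic.ConjugateSelfDualInfinityType
import Literature.NumberTheory.Automorphic.IdeleClassCharacterHecke
import Literature.NumberTheory.Automorphic.QuadraticHeckeCharacterCMInfinityType
import HarnessLib

/-!
# Splitting characters of unitary dual pairs over a CM field: class-group form, parity, ∞-types

The splitting characters `χ_V, χ_W` of a unitary dual pair `(U(V), U(W))` over a CM field `L` (with
`F = L⁺`) are unitary Hecke characters of `L` with `χ|_{𝕀_{L⁺}} = ε_{L/L⁺}^{m}`, `m = dim V` (resp. `dim W`)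
— [HarrisKudlaSweet1996, (1.5) p. 951], the tree's `IsSplittingChar L m χ` and the data structure
`SplittingCharacters L m n` (`GlobalSplittingCharacters`).  This file connects them with the idele CLASS
group side of the tree — the circle-valued characters `ψ : C_L →ₜ* S¹` of `IdeleClassCharacterHecke`
(`toHeckeCharacter`), the conjugate symplectic / orthogonal characters of [Liu2021, Def. 4.1]
(`ConjugateSelfDualCharacters`) and their ∞-types (`HasInfinityType`; existence [Liu2021, Remark 4.2] =
`ConjugateSelfDualInfinityType`):

* § 1 `unitaryClassChar K χ hχ : IdeleClassGroup K →ₜ* Circle` — a UNITARY Hecke character as a circle-valued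
  idele class character; inverse to `toHeckeCharacter` on both sides (`toHeckeCharacter_unitaryClassChar`,
  `unitaryClassChar_toHeckeCharacter`); `exists_toHeckeCharacter_eq_of_isUnitary`; dictionary of ∞-types
  `hasUnitaryArchType_iff_hasInfinityType_unitaryClassChar` (`χ.HasUnitaryArchType e 0 ↔ HasInfinityType`).
* § 2 `isSplittingChar_toHeckeCharacter_iff` — (1.5) for `toHeckeCharacter ψ` iff
  `ψ ∘ (C_{L⁺} → C_L) = (quadraticClassCharCM L)^m`; hence for ODD `m` (1.5) ⟺ `IsConjugateSymplectic L ψ`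
  and for EVEN `m` (1.5) ⟺ `IsConjugateOrthogonal L ψ` ([Liu2021, Def. 4.1]);
  `IsSplittingChar.isConjugateSymplectic` / `.isConjugateOrthogonal`; the PARITY CONSTRAINT
  `IsSplittingChar.modEq_of_hasUnitaryArchType`: a unitary splitting character of unitary archimedean type
  `(e, 0)` has `e_w ≡ m (mod 2)` ([Liu2021, Remark 4.2]: `𝔴_μ` odd / even).
* § 3 EXISTENCE with prescribed ∞-type: `exists_isSplittingChar_hasUnitaryArchType m e (he : e_w ≡ m mod 2)`,
  `exists_splittingCharacters_hasUnitaryArchType m n eV eW` — kernel, from the tree's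
  `exists_ideleClassChar_of_isCMField` (`QuadraticHeckeCharacterCMInfinityType`).
* § 4 every unitary splitting character HAS a (unique) unitary archimedean type `(e, 0)`, `e_w ≡ m (mod 2)`:
  `IsSplittingChar.exists_hasUnitaryArchType` / `existsUnique_…` ([Liu2021, Remark 4.2] existence, the tree's
  `IsConjugateSymplectic.exists_hasInfinityType` / `IsConjugateSelfDual.exists_hasInfinityType` of
  `ConjugateSelfDualInfinityType`), `hasUnitaryArchType_zero_unique`; as FUNCTIONS of the splitting data:
  `SplittingCharacters.archTypeV` / `archTypeW` with `hasUnitaryArchType_archTypeV/W`, `archTypeV/W_modEq`,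
  `archTypeV/W_eq` — the ∞-types `(e_V, e_W)` that fix the weights of the theta forms.

No statement is asserted without proof; [HarrisKudlaSweet1996] enters only through the tree's definition
`IsSplittingChar` (its docstring quotes (1.5)), [Liu2021] only through the tree's definitions
`IsConjugateSymplectic` / `IsConjugateOrthogonal` / `HasInfinityType` and kernel theorems about them.

## References

* M. Harris, S. Kudla, W. J. Sweet, *Theta dichotomy for unitary groups*, J. Amer. Math. Soc. 9 (1996),
  941–1004 — (1.5) p. 951. [HarrisKudlaSweet1996]
* Y. Liu, *Fourier–Jacobi cycles and arithmetic relative trace formula*, Camb. J. Math. 9 (2021), no. 1,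
  1–147, arXiv:2102.11518 — §4.1 Definition 4.1, Remark 4.2 (p. 18 of the arXiv text). [Liu2021]
* A. Weil, *Basic Number Theory* (1967), Ch. VII §3 (characters of idele class groups). [WeilBNT1967]
-/

set_option autoImplicit false

noncomputable section

open NumberField NumberField.InfinitePlace

namespace Literature.RepresentationTheory.HarrisKudlaSweet1996

open _root_.Literature.NumberTheory.GaloisRepresentations (HeckeCharacter ideleGroup)
open _root_.Literature.NumberTheory.Automorphic
open _root_.Literature.NumberTheory.Automorphic.IdeleClassGroup

/-! ## § 1. Unitary Hecke characters as circle-valued idele class characters -/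

section Unitary

variable (K : Type) [Field K] [NumberField K]

/-- A UNITARY Hecke character `χ : 𝕀_K → ℂˣ` (`‖χ‖ = 1`, trivial on `Kˣ`) as a continuous character
`C_K →ₜ* S¹` (the tree's `HeckeCharacter.toIdeleClassCharacter` followed by `unitaryToCircle`); inverse to
`IdeleClassGroup.toHeckeCharacter` (`toHeckeCharacter_unitaryClassChar`, `unitaryClassChar_toHeckeCharacter`).
[cite: WeilBNT1967, Ch. VII §3] -/
def unitaryClassChar (χ : HeckeCharacter K) (hχ : χ.IsUnitary) : IdeleClassGroup K →ₜ* Circle :=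
  unitaryToCircle χ.toIdeleClassCharacter fun c => QuotientGroup.induction_on c fun x => hχ x

/-- Evaluation on the class of an idele: `unitaryClassChar χ [x] = χ x` in `ℂ`. [folklore] -/
@[simp] theorem coe_unitaryClassChar_mk (χ : HeckeCharacter K) (hχ : χ.IsUnitary) (x : ideleGroup K) :
    ((unitaryClassChar K χ hχ (x : IdeleClassGroup K) : Circle) : ℂ) = ((χ x : ℂˣ) : ℂ) :=
  rfl

/-- `toHeckeCharacter (unitaryClassChar χ) = χ`. [folklore] -/
@[simp] theorem toHeckeCharacter_unitaryClassChar (χ : HeckeCharacter K) (hχ : χ.IsUnitary) :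
    toHeckeCharacter K (unitaryClassChar K χ hχ) = χ :=
  HeckeCharacter.ext fun x => Units.ext (by rw [coe_toHeckeCharacter_apply, coe_unitaryClassChar_mk])

/-- `unitaryClassChar (toHeckeCharacter ψ) = ψ`. [folklore] -/
@[simp] theorem unitaryClassChar_toHeckeCharacter (ψ : IdeleClassGroup K →ₜ* Circle) :
    unitaryClassChar K (toHeckeCharacter K ψ) (isUnitary_toHeckeCharacter K ψ) = ψ :=
  ContinuousMonoidHom.ext fun c => QuotientGroup.induction_on c fun _ => Circle.ext rfl

/-- Every unitary Hecke character is `toHeckeCharacter ψ` for a (unique, `toHeckeCharacter_injective`)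
`ψ : C_K →ₜ* S¹`. [cite: WeilBNT1967, Ch. VII §3] -/
theorem exists_toHeckeCharacter_eq_of_isUnitary {χ : HeckeCharacter K} (hχ : χ.IsUnitary) :
    ∃ ψ : IdeleClassGroup K →ₜ* Circle, toHeckeCharacter K ψ = χ :=
  ⟨unitaryClassChar K χ hχ, toHeckeCharacter_unitaryClassChar K χ hχ⟩

/-- ∞-types through the dictionary: `χ` has unitary archimedean type `(e, 0)` iff `unitaryClassChar χ` has
∞-type `e`. [folklore] -/
theorem hasUnitaryArchType_iff_hasInfinityType_unitaryClassChar (χ : HeckeCharacter K) (hχ : χ.IsUnitary)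
    (e : InfinitePlace K → ℤ) :
    χ.HasUnitaryArchType e 0 ↔ HasInfinityType K (unitaryClassChar K χ hχ) e := by
  rw [← hasUnitaryArchType_toHeckeCharacter_iff, toHeckeCharacter_unitaryClassChar]

end Unitary

/-! ## § 2. The splitting condition (1.5) on idele CLASS groups; parity = conjugate symplectic / orthogonal -/

variable (L : Type) [Field L] [NumberField L] [IsCMField L]

local notation3 "L⁺" => maximalRealSubfield L

/-- **(1.5) in class-group form.** For `ψ : C_L →ₜ* S¹`: `toHeckeCharacter ψ |_{𝕀_{L⁺}} = ε^m` iff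
`ψ ∘ (C_{L⁺} → C_L) = ε^m` with the circle-valued class character `ε = quadraticClassCharCM L`.
[cite: HarrisKudlaSweet1996, (1.5) p. 951] -/
theorem isSplittingChar_toHeckeCharacter_iff (m : ℕ) (ψ : IdeleClassGroup L →ₜ* Circle) :
    IsSplittingChar L m (toHeckeCharacter L ψ) ↔
      ∀ a : IdeleClassGroup L⁺, ψ (classBaseChange L⁺ L a) = quadraticClassCharCM L a ^ m := by
  constructor
  · intro h a
    induction a using QuotientGroup.induction_on with
    | H x =>
      apply Circle.ext
      rw [classBaseChange_mk, Circle.coe_pow, coe_quadraticClassCharCM_mk, ← coe_toHeckeCharacter_apply, h x,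
        Units.val_pow_eq_pow_val]
  · intro h x
    apply Units.ext
    rw [coe_toHeckeCharacter_apply, Units.val_pow_eq_pow_val, ← coe_quadraticClassCharCM_mk, ← Circle.coe_pow,
      ← h, classBaseChange_mk]

variable {L}

/-- For ODD `m` (e.g. `m = dim V = 3`, `1`): `toHeckeCharacter ψ` satisfies (1.5) iff `ψ` is CONJUGATE
SYMPLECTIC in the sense of [Liu2021, Def. 4.1]. [cite: HarrisKudlaSweet1996, (1.5) p. 951]
[cite: Liu2021, Definition 4.1] -/
theorem isSplittingChar_toHeckeCharacter_iff_isConjugateSymplectic {m : ℕ} (hm : Odd m)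
    (ψ : IdeleClassGroup L →ₜ* Circle) :
    IsSplittingChar L m (toHeckeCharacter L ψ) ↔ IsConjugateSymplectic L ψ := by
  rw [isSplittingChar_iff_mod_two, Nat.odd_iff.mp hm, isSplittingChar_toHeckeCharacter_iff]
  simp only [pow_one]
  rfl

/-- For EVEN `m` (e.g. `m = 2`, `0`): `toHeckeCharacter ψ` satisfies (1.5) iff `ψ` is CONJUGATE ORTHOGONAL.
[cite: HarrisKudlaSweet1996, (1.5) p. 951] [cite: Liu2021, Definition 4.1] -/
theorem isSplittingChar_toHeckeCharacter_iff_isConjugateOrthogonal {m : ℕ} (hm : Even m)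
    (ψ : IdeleClassGroup L →ₜ* Circle) :
    IsSplittingChar L m (toHeckeCharacter L ψ) ↔ IsConjugateOrthogonal L ψ := by
  rw [isSplittingChar_iff_mod_two, Nat.even_iff.mp hm, isSplittingChar_toHeckeCharacter_iff]
  simp only [pow_zero]
  rfl

/-- A unitary splitting character for odd `m` IS a conjugate symplectic character. [folklore] -/
theorem IsSplittingChar.isConjugateSymplectic {m : ℕ} (hm : Odd m) {χ : HeckeCharacter L} (hχ : χ.IsUnitary)
    (h : IsSplittingChar L m χ) : IsConjugateSymplectic L (unitaryClassChar L χ hχ) := by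
  rw [← isSplittingChar_toHeckeCharacter_iff_isConjugateSymplectic hm, toHeckeCharacter_unitaryClassChar]
  exact h

/-- A unitary splitting character for even `m` IS a conjugate orthogonal character. [folklore] -/
theorem IsSplittingChar.isConjugateOrthogonal {m : ℕ} (hm : Even m) {χ : HeckeCharacter L}
    (hχ : χ.IsUnitary) (h : IsSplittingChar L m χ) : IsConjugateOrthogonal L (unitaryClassChar L χ hχ) := by
  rw [← isSplittingChar_toHeckeCharacter_iff_isConjugateOrthogonal hm, toHeckeCharacter_unitaryClassChar]
  exact h

/-- **Parity constraint on the ∞-type [Liu2021, Remark 4.2]:** a unitary splitting character for `m` of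
unitary archimedean type `(e, 0)` has `e_w ≡ m (mod 2)` at every place. [cite: Liu2021, Remark 4.2] -/
theorem IsSplittingChar.modEq_of_hasUnitaryArchType {m : ℕ} {χ : HeckeCharacter L} (hχ : χ.IsUnitary)
    (h : IsSplittingChar L m χ) {e : InfinitePlace L → ℤ} (he : χ.HasUnitaryArchType e 0)
    (w : InfinitePlace L) : e w ≡ m [ZMOD 2] := by
  rw [hasUnitaryArchType_iff_hasInfinityType_unitaryClassChar L χ hχ] at he
  rcases Nat.even_or_odd m with hm | hm
  · obtain ⟨k, hk⟩ := (h.isConjugateOrthogonal hm hχ).even he w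
    obtain ⟨j, hj⟩ := hm
    exact Int.modEq_iff_dvd.2 ⟨j - k, by rw [hk, hj]; push_cast; ring⟩
  · obtain ⟨k, hk⟩ := (h.isConjugateSymplectic hm hχ).odd he w
    obtain ⟨j, hj⟩ := hm
    exact Int.modEq_iff_dvd.2 ⟨j - k, by rw [hk, hj]; push_cast; ring⟩

/-! ## § 3. Existence of splitting characters with PRESCRIBED unitary archimedean type -/

variable (L)

/-- **Unitary splitting characters with prescribed ∞-type exist**: for every `m` and every tuple `e` with
`e_w ≡ m (mod 2)` there is a unitary Hecke character `χ` of `L` with `χ|_{𝕀_{L⁺}} = ε^m` and unitary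
archimedean type `(e, 0)` (`χ_w(z) = (z/|z|)^{-e_w}`-type components).  Kernel: the tree's
`exists_ideleClassChar_of_isCMField` (W8-C12) through `toHeckeCharacter`. [folklore] -/
theorem exists_isSplittingChar_hasUnitaryArchType (m : ℕ) (e : InfinitePlace L → ℤ)
    (he : ∀ w, e w ≡ (m : ℤ) [ZMOD 2]) :
    ∃ χ : HeckeCharacter L, χ.IsUnitary ∧ IsSplittingChar L m χ ∧ χ.HasUnitaryArchType e 0 := by
  obtain ⟨ψ, hψ, hres⟩ := exists_ideleClassChar_of_isCMField L (m : ℤ) e he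
  refine ⟨toHeckeCharacter L ψ, isUnitary_toHeckeCharacter L ψ,
    (isSplittingChar_toHeckeCharacter_iff L m ψ).2 fun a => ?_,
    (hasUnitaryArchType_toHeckeCharacter_iff L ψ e).2 hψ⟩
  rw [hres a, zpow_natCast]

/-- **Splitting characters `(χ_V, χ_W)` with prescribed ∞-types exist** for every `(m, n)` and all tuples
`e_V ≡ m`, `e_W ≡ n (mod 2)`. [folklore] -/
theorem exists_splittingCharacters_hasUnitaryArchType (m n : ℕ) (eV eW : InfinitePlace L → ℤ)
    (hV : ∀ w, eV w ≡ (m : ℤ) [ZMOD 2]) (hW : ∀ w, eW w ≡ (n : ℤ) [ZMOD 2]) :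
    ∃ S : SplittingCharacters L m n, S.χV.HasUnitaryArchType eV 0 ∧ S.χW.HasUnitaryArchType eW 0 := by
  obtain ⟨χV, hVu, hVs, hVa⟩ := exists_isSplittingChar_hasUnitaryArchType L m eV hV
  obtain ⟨χW, hWu, hWs, hWa⟩ := exists_isSplittingChar_hasUnitaryArchType L n eW hW
  exact ⟨⟨χV, hVu, hVs, χW, hWu, hWs⟩, hVa, hWa⟩

/-! ## § 4. Every unitary splitting character HAS a unitary archimedean type ([Liu2021] Remark 4.2) -/

variable {L}

/-- **A unitary splitting character has an ∞-type**: if `χ` is unitary with `χ|_{𝕀_{L⁺}} = ε^m`, then `χ` has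
unitary archimedean type `(e, 0)` for some tuple `e` with `e_w ≡ m (mod 2)` — [Liu2021, Remark 4.2] (existence
of `𝔴_μ`, via `IsConjugateSymplectic.exists_hasInfinityType` / `IsConjugateSelfDual.exists_hasInfinityType`)
transported through `unitaryClassChar`. [cite: Liu2021, Remark 4.2] -/
theorem IsSplittingChar.exists_hasUnitaryArchType {m : ℕ} {χ : HeckeCharacter L} (hχ : χ.IsUnitary)
    (h : IsSplittingChar L m χ) :
    ∃ e : InfinitePlace L → ℤ, χ.HasUnitaryArchType e 0 ∧ ∀ w, e w ≡ (m : ℤ) [ZMOD 2] := by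
  have hex : ∃ e, HasInfinityType L (unitaryClassChar L χ hχ) e := by
    rcases Nat.even_or_odd m with hm | hm
    · exact (h.isConjugateOrthogonal hm hχ).isConjugateSelfDual.exists_hasInfinityType
    · exact (h.isConjugateSymplectic hm hχ).exists_hasInfinityType
  obtain ⟨e, he⟩ := hex
  have he' : χ.HasUnitaryArchType e 0 :=
    (hasUnitaryArchType_iff_hasInfinityType_unitaryClassChar L χ hχ e).2 he
  exact ⟨e, he', h.modEq_of_hasUnitaryArchType hχ he'⟩

/-- The unitary archimedean type `(e, 0)` of a unitary Hecke character is unique. [folklore] -/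
theorem hasUnitaryArchType_zero_unique {χ : HeckeCharacter L} (hχ : χ.IsUnitary) {e e' : InfinitePlace L → ℤ}
    (he : χ.HasUnitaryArchType e 0) (he' : χ.HasUnitaryArchType e' 0) : e = e' := by
  rw [hasUnitaryArchType_iff_hasInfinityType_unitaryClassChar L χ hχ] at he he'
  exact hasInfinityType_unique he he'

/-- … so the ∞-type of a unitary splitting character exists uniquely. [cite: Liu2021, Remark 4.2] -/
theorem IsSplittingChar.existsUnique_hasUnitaryArchType {m : ℕ} {χ : HeckeCharacter L} (hχ : χ.IsUnitary)
    (h : IsSplittingChar L m χ) : ∃! e : InfinitePlace L → ℤ, χ.HasUnitaryArchType e 0 := by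
  obtain ⟨e, he, -⟩ := h.exists_hasUnitaryArchType hχ
  exact ⟨e, he, fun e' he' => hasUnitaryArchType_zero_unique hχ he' he⟩

namespace SplittingCharacters

variable {m n : ℕ}

/-- `χ_V` has a unitary archimedean type `(e_V, 0)` with `e_V ≡ m (mod 2)`. [cite: Liu2021, Remark 4.2] -/
theorem exists_hasUnitaryArchType_χV (S : SplittingCharacters L m n) :
    ∃ e : InfinitePlace L → ℤ, S.χV.HasUnitaryArchType e 0 ∧ ∀ w, e w ≡ (m : ℤ) [ZMOD 2] :=
  S.χV_splitting.exists_hasUnitaryArchType S.χV_isUnitary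

/-- `χ_W` has a unitary archimedean type `(e_W, 0)` with `e_W ≡ n (mod 2)`. [cite: Liu2021, Remark 4.2] -/
theorem exists_hasUnitaryArchType_χW (S : SplittingCharacters L m n) :
    ∃ e : InfinitePlace L → ℤ, S.χW.HasUnitaryArchType e 0 ∧ ∀ w, e w ≡ (n : ℤ) [ZMOD 2] :=
  S.χW_splitting.exists_hasUnitaryArchType S.χW_isUnitary

/-- **The ∞-type `e_V` of `χ_V`** as a function of the splitting data (choice; characterised by
`hasUnitaryArchType_archTypeV` and `archTypeV_eq`). [cite: Liu2021, Remark 4.2] -/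
def archTypeV (S : SplittingCharacters L m n) : InfinitePlace L → ℤ :=
  S.exists_hasUnitaryArchType_χV.choose

/-- `χ_V` has unitary archimedean type `(S.archTypeV, 0)`. [folklore] -/
theorem hasUnitaryArchType_archTypeV (S : SplittingCharacters L m n) : S.χV.HasUnitaryArchType S.archTypeV 0 :=
  S.exists_hasUnitaryArchType_χV.choose_spec.1

/-- `S.archTypeV w ≡ m (mod 2)`. [folklore] -/
theorem archTypeV_modEq (S : SplittingCharacters L m n) (w : InfinitePlace L) : S.archTypeV w ≡ (m : ℤ) [ZMOD 2] :=
  S.exists_hasUnitaryArchType_χV.choose_spec.2 w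

/-- Any unitary archimedean type `(e, 0)` of `χ_V` is `S.archTypeV`. [folklore] -/
theorem archTypeV_eq (S : SplittingCharacters L m n) {e : InfinitePlace L → ℤ} (he : S.χV.HasUnitaryArchType e 0) :
    S.archTypeV = e :=
  hasUnitaryArchType_zero_unique S.χV_isUnitary S.hasUnitaryArchType_archTypeV he

/-- **The ∞-type `e_W` of `χ_W`** as a function of the splitting data. [cite: Liu2021, Remark 4.2] -/
def archTypeW (S : SplittingCharacters L m n) : InfinitePlace L → ℤ :=
  S.exists_hasUnitaryArchType_χW.choose

/-- `χ_W` has unitary archimedean type `(S.archTypeW, 0)`. [folklore] -/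
theorem hasUnitaryArchType_archTypeW (S : SplittingCharacters L m n) : S.χW.HasUnitaryArchType S.archTypeW 0 :=
  S.exists_hasUnitaryArchType_χW.choose_spec.1

/-- `S.archTypeW w ≡ n (mod 2)`. [folklore] -/
theorem archTypeW_modEq (S : SplittingCharacters L m n) (w : InfinitePlace L) : S.archTypeW w ≡ (n : ℤ) [ZMOD 2] :=
  S.exists_hasUnitaryArchType_χW.choose_spec.2 w

/-- Any unitary archimedean type `(e, 0)` of `χ_W` is `S.archTypeW`. [folklore] -/
theorem archTypeW_eq (S : SplittingCharacters L m n) {e : InfinitePlace L → ℤ} (he : S.χW.HasUnitaryArchType e 0) :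
    S.archTypeW = e :=
  hasUnitaryArchType_zero_unique S.χW_isUnitary S.hasUnitaryArchType_archTypeW he

end SplittingCharacters

end Literature.RepresentationTheory.HarrisKudlaSweet1996

end
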